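import Summits.QuantumAdvantage.QuantumAdvantage.Theses.LinnikCubicClassGroups
import Literature.Computability.Complexity.CoinBlockRejectionSampling
import Literature.Computability.Complexity.CountingHierarchyProofs
import Literature.Computability.Complexity.AlgebraicQueryRectangles

/-!
# Crux `LinnikCubicClassGroups.PureCubicClassGroupFBQP` (stmt-QuantumAdvantage-11544) — stub `stub_assemblyCoins`

Line `arakelov-giant-step-cycle`, stub S6c (skeleton v6): **the coin bound of the sampler.** From S4b's counts
with its constant `C` — density `X ≤ 4B·#G` of the good primes `G = {p ≤ X prime, p ∤ 3m}`, `B = log₂ X + 1`, and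
"at most `1/8` of the `T`-tuples of good primes fail to generate" for `T ≥ 600 B²` — the sampler that reads
`T = 600 B²` groups of `M = 38400 B³ = 64TB` blocks of `B` coins and keeps in each group the first block value in
`G` hands primes whose degree-one classes generate `Cl(𝓞 K)` with probability `≥ 3/4`, for every admissible `K`
and non-cube `m = decodeNat x`, over `q(|x|) ≥ TMB` coins.

Proof: the tree's rejection-sampling brick `uniformProb_blockRejection_le` (`CoinBlockRejectionSampling.lean`:
some group fails with probability `≤ T(1 − #G/2^B)^M`; conditioned on success the kept values are independent and
uniform on `G`, so a bad set of density `≤ 1/8` is hit with probability `≤ 1/8`), the estimates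
`#G/2^B ≥ 1/(8B)` (density and `2^B ≤ 2X`), `(1 − 1/(8B))^{64TB} ≤ e^{−8T}` (`Real.one_sub_le_exp_neg`),
`16T ≤ e^{8T}`, and `uniformProb_take_of_le` (only the first `TMB ≤ q(|x|)` coins are read).
-/

set_option linter.dupNamespace false

namespace Summit.QuantumAdvantage.QuantumAdvantage.Theorems.LinnikCubicClassGroups

open Computability (encodeNat decodeNat)
open Literature.Computability.Complexity (uniformProb uniformProb_univ uniformProb_take_of_le bitsToNat
  uniformProb_blockRejection_le decodeNat_lt_two_pow_succ)
open scoped NumberField nonZeroDivisors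

/-- `16 T ≤ e^{8T}`, whence `T e^{−8T} ≤ 1/16`. -/
theorem assemblyCoins_exp_bound (T : ℝ) (hT : 0 ≤ T) : T * Real.exp (-(8 * T)) ≤ 1 / 16 := by
  have h4 : 4 * T + 1 ≤ Real.exp (4 * T) := Real.add_one_le_exp _
  have h8 : 16 * T ≤ Real.exp (8 * T) := by
    have : Real.exp (8 * T) = Real.exp (4 * T) ^ 2 := by rw [← Real.exp_nat_mul]; ring_nf
    rw [this]
    nlinarith [h4, sq_nonneg (4 * T - 1)]
  rw [Real.exp_neg, mul_inv_le_iff₀ (Real.exp_pos _)]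
  linarith

/-- The union bound turned around: if `E ∪ F` is everything then `1 − Pr[F] ≤ Pr[E]`. -/
theorem assemblyCoins_one_sub_le {n : ℕ} {E F : Set (List Bool)} (h : ∀ c, c ∈ E ∨ c ∈ F) :
    1 - uniformProb n F ≤ uniformProb n E := by
  have hu : uniformProb n (E ∪ F) = 1 := by
    rw [Set.eq_univ_of_forall (s := E ∪ F) fun c => h c, uniformProb_univ]
  have := Literature.Computability.Complexity.uniformProb_union_le n E F
  linarith

/-- The final bookkeeping: an event that reads only the first `N ≤ n` coins and whose complement lies in a failure
event of probability `≤ 1/4` has probability `≥ 3/4` over `n` coins. -/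
theorem assemblyCoins_finish {N n : ℕ} {E F : Set (List Bool)} {δ : ℝ} (hN : N ≤ n) (hE : ∀ c, c ∈ E ↔ c.take N ∈ E)
    (hEF : ∀ c, c ∈ E ∨ c ∈ F) (hF : uniformProb N F ≤ δ) (hδ : δ ≤ 1 / 4) : (3 : ℝ) / 4 ≤ uniformProb n E := by
  have h := assemblyCoins_one_sub_le (n := N) hEF
  have hEq : uniformProb n E = uniformProb N E := by
    rw [← uniformProb_take_of_le hN E]
    congr 1
    ext c
    exact hE c
  rw [hEq]
  linarith

/-- **S6c `stub_assemblyCoins`** (registered signature, skeleton v6): the `3/4` coin bound of the sampler. -/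
theorem stub_assemblyCoins : ∀ C : ℕ,
    (∀ (K : Type) [Field K] [NumberField K],
      Module.finrank ℚ K = 3 → ∀ m : ℕ, (∀ r : ℕ, r ^ 3 ≠ m) → (∃ α : K, α ^ 3 = (m : K)) →
      ∀ X : ℕ, (27 * m ^ 2) ^ C ≤ X →
        X ≤ 4 * (Nat.log 2 X + 1) * Nat.card {p : ℕ // p.Prime ∧ p ≤ X ∧ ¬ p ∣ 3 * m} ∧
        ∀ T : ℕ, 600 * (Nat.log 2 X + 1) ^ 2 ≤ T →
          8 * Nat.card {v : Fin T → {p : ℕ // p.Prime ∧ p ≤ X ∧ ¬ p ∣ 3 * m} //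
              Subgroup.closure {c : ClassGroup (𝓞 K) | ∃ i : Fin T, ∃ P : Ideal (𝓞 K),
                ∃ hP : P ∈ nonZeroDivisors (Ideal (𝓞 K)),
                  P.IsPrime ∧ Ideal.absNorm P = (v i : ℕ) ∧ c = ClassGroup.mk0 ⟨P, hP⟩} ≠ ⊤} ≤
            Nat.card {p : ℕ // p.Prime ∧ p ≤ X ∧ ¬ p ∣ 3 * m} ^ T) →
    ∃ q : Polynomial ℕ, ∀ x : List Bool, (∀ r : ℕ, r ^ 3 ≠ decodeNat x) →
      ∀ (K : Type) [Field K] [NumberField K], Module.finrank ℚ K = 3 → (∃ α : K, α ^ 3 = (decodeNat x : K)) →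
        (3 : ℝ) / 4 ≤ uniformProb (q.eval x.length) {c | Subgroup.closure {g : ClassGroup (𝓞 K) |
          ∃ p ∈ (((List.range (600 * (Nat.log 2 ((27 * decodeNat x ^ 2) ^ C) + 1) ^ 2)).filterMap fun k =>
            ((List.range (38400 * (Nat.log 2 ((27 * decodeNat x ^ 2) ^ C) + 1) ^ 3)).map fun j =>
              bitsToNat ((c.drop ((k * (38400 * (Nat.log 2 ((27 * decodeNat x ^ 2) ^ C) + 1) ^ 3) + j) *
                (Nat.log 2 ((27 * decodeNat x ^ 2) ^ C) + 1))).take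
                (Nat.log 2 ((27 * decodeNat x ^ 2) ^ C) + 1))).find? fun v =>
              decide (v.Prime ∧ v ≤ (27 * decodeNat x ^ 2) ^ C ∧ ¬ v ∣ 3 * decodeNat x))),
            ∃ P : Ideal (𝓞 K), ∃ hP : P ∈ nonZeroDivisors (Ideal (𝓞 K)),
              P.IsPrime ∧ Ideal.absNorm P = p ∧ g = ClassGroup.mk0 ⟨P, hP⟩} = ⊤} := by
  intro C hC
  refine ⟨Polynomial.C 23040000 * (Polynomial.C C * (2 * Polynomial.X + 7) + 1) ^ 6, fun x hnc K _ _ hK hα => ?_⟩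
  -- parameters
  set m := decodeNat x with hm
  set X := (27 * m ^ 2) ^ C with hX
  set B := Nat.log 2 X + 1 with hB
  have hm0 : m ≠ 0 := fun h => hnc 0 (by rw [h]; norm_num)
  have hX1 : 1 ≤ X := Nat.one_le_pow _ _ (Nat.mul_pos (by norm_num) (pow_pos (Nat.pos_of_ne_zero hm0) 2))
  have hXB : X < 2 ^ B := Nat.lt_pow_succ_log_self (by norm_num) X
  have h2B : 2 ^ B ≤ 2 * X := by rw [hB, pow_succ]; have := Nat.pow_log_le_self 2 (by omega : X ≠ 0); omega
  obtain ⟨hdens, hgen⟩ := hC K hK m hnc hα X le_rfl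
  have hbad := hgen (600 * B ^ 2) le_rfl
  -- the good primes
  set G := {p : ℕ // p.Prime ∧ p ≤ X ∧ ¬ p ∣ 3 * m} with hG
  haveI : Finite G := Finite.of_injective (fun p => (⟨p.1, Nat.lt_succ_of_le p.2.2.1⟩ : Fin (X + 1)))
    fun p q h => Subtype.ext (by simpa using congrArg Fin.val h)
  have hGpos : 1 ≤ Nat.card G := by
    by_contra h0
    push Not at h0
    rw [Nat.lt_one_iff.1 h0, mul_zero] at hdens
    omega
  have hG0 : ∃ v : ℕ, v.Prime ∧ v ≤ X ∧ ¬ v ∣ 3 * m := by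
    by_contra h
    push Not at h
    haveI : IsEmpty G := ⟨fun p => p.2.2.2 (h p.1 p.2.1 p.2.2.1)⟩
    rw [Nat.card_of_isEmpty] at hGpos
    exact absurd hGpos (by norm_num)
  -- the coin length
  have hBle : B ≤ C * (2 * x.length + 7) + 1 := by
    rw [hB, Nat.add_le_add_iff_right]
    rcases Nat.eq_zero_or_pos C with hC0 | hC0
    · rw [hX, hC0, pow_zero, Nat.log_one_right]; exact Nat.zero_le _
    have hmlt : m < 2 ^ (x.length + 1) := decodeNat_lt_two_pow_succ x
    have hXlt : X < 2 ^ (C * (2 * x.length + 7)) := by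
      rw [hX, Nat.mul_comm C, pow_mul]
      refine Nat.pow_lt_pow_left ?_ hC0.ne'
      calc 27 * m ^ 2 < 32 * (2 ^ (x.length + 1)) ^ 2 :=
            (Nat.mul_le_mul_right _ (by norm_num)).trans_lt
              (Nat.mul_lt_mul_of_pos_left (Nat.pow_lt_pow_left hmlt two_ne_zero) (by norm_num))
        _ = 2 ^ (2 * x.length + 7) := by rw [← pow_mul, show (32 : ℕ) = 2 ^ 5 by norm_num, ← pow_add]; ring_nf
    exact ((Nat.log_lt_iff_lt_pow (by norm_num) (by omega)).2 hXlt).le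
  have hq : 600 * B ^ 2 * (38400 * B ^ 3 * B) ≤
      (Polynomial.C 23040000 * (Polynomial.C C * (2 * Polynomial.X + 7) + 1) ^ 6 : Polynomial ℕ).eval x.length := by
    simp only [Polynomial.eval_mul, Polynomial.eval_C, Polynomial.eval_pow, Polynomial.eval_add, Polynomial.eval_X,
      Polynomial.eval_one, Polynomial.eval_ofNat]
    calc 600 * B ^ 2 * (38400 * B ^ 3 * B) = 23040000 * B ^ 6 := by ring
      _ ≤ 23040000 * (C * (2 * x.length + 7) + 1) ^ 6 := Nat.mul_le_mul_left _ (Nat.pow_le_pow_left hBle 6)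
  -- forget the bodies of the parameters (tactics must not unfold `Nat.log` / `decodeNat`)
  clear_value B X m
  -- the count hypothesis of the rejection-sampling brick
  have hcountSet : ∀ w : Fin (600 * B ^ 2) → G,
      {g : ClassGroup (𝓞 K) | ∃ p ∈ List.ofFn (fun i => ((w i : ℕ))), ∃ P : Ideal (𝓞 K),
        ∃ hP : P ∈ nonZeroDivisors (Ideal (𝓞 K)), P.IsPrime ∧ Ideal.absNorm P = p ∧ g = ClassGroup.mk0 ⟨P, hP⟩} =
      {g : ClassGroup (𝓞 K) | ∃ i : Fin (600 * B ^ 2), ∃ P : Ideal (𝓞 K), ∃ hP : P ∈ nonZeroDivisors (Ideal (𝓞 K)),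
        P.IsPrime ∧ Ideal.absNorm P = (w i : ℕ) ∧ g = ClassGroup.mk0 ⟨P, hP⟩} := by
    intro w; ext g
    simp only [Set.mem_setOf_eq, List.mem_ofFn]
    constructor
    · rintro ⟨_, ⟨i, rfl⟩, P, hP, h1, h2, h3⟩; exact ⟨i, P, hP, h1, h2, h3⟩
    · rintro ⟨i, P, hP, h1, h2, h3⟩; exact ⟨_, ⟨i, rfl⟩, P, hP, h1, h2, h3⟩
  have hbadR : (Nat.card {w : Fin (600 * B ^ 2) → G // (List.ofFn fun i => ((w i : ℕ))) ∈
      {l : List ℕ | Subgroup.closure {g : ClassGroup (𝓞 K) | ∃ p ∈ l, ∃ P : Ideal (𝓞 K),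
        ∃ hP : P ∈ nonZeroDivisors (Ideal (𝓞 K)), P.IsPrime ∧ Ideal.absNorm P = p ∧ g = ClassGroup.mk0 ⟨P, hP⟩} ≠ ⊤}} : ℝ) ≤
      1 / 8 * (Nat.card G : ℝ) ^ (600 * B ^ 2) := by
    have hc : Nat.card {w : Fin (600 * B ^ 2) → G // (List.ofFn fun i => ((w i : ℕ))) ∈
        {l : List ℕ | Subgroup.closure {g : ClassGroup (𝓞 K) | ∃ p ∈ l, ∃ P : Ideal (𝓞 K),
          ∃ hP : P ∈ nonZeroDivisors (Ideal (𝓞 K)), P.IsPrime ∧ Ideal.absNorm P = p ∧ g = ClassGroup.mk0 ⟨P, hP⟩} ≠ ⊤}} =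
        Nat.card {v : Fin (600 * B ^ 2) → G // Subgroup.closure {c : ClassGroup (𝓞 K) | ∃ i : Fin (600 * B ^ 2),
          ∃ P : Ideal (𝓞 K), ∃ hP : P ∈ nonZeroDivisors (Ideal (𝓞 K)),
            P.IsPrime ∧ Ideal.absNorm P = (v i : ℕ) ∧ c = ClassGroup.mk0 ⟨P, hP⟩} ≠ ⊤} :=
      Nat.card_congr (Equiv.subtypeEquivRight fun w => by rw [Set.mem_setOf_eq, hcountSet w])
    rw [hc]
    have h' := (Nat.cast_le (α := ℝ)).2 hbad
    push_cast at h'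
    linarith
  -- the rejection-sampling brick
  have key := uniformProb_blockRejection_le (B := B) (T := 600 * B ^ 2) (M := 38400 * B ^ 3)
    (fun v : ℕ => v.Prime ∧ v ≤ X ∧ ¬ v ∣ 3 * m) (fun v hv => lt_of_le_of_lt hv.2.1 hXB) hG0
    {l : List ℕ | Subgroup.closure {g : ClassGroup (𝓞 K) | ∃ p ∈ l, ∃ P : Ideal (𝓞 K),
      ∃ hP : P ∈ nonZeroDivisors (Ideal (𝓞 K)), P.IsPrime ∧ Ideal.absNorm P = p ∧ g = ClassGroup.mk0 ⟨P, hP⟩} ≠ ⊤}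
    (by norm_num : (0 : ℝ) ≤ 1 / 8) hbadR
  -- the failure bound `T (1 − #G/2^B)^M ≤ 1/16`
  have hBpos : (1 : ℝ) ≤ B := by rw [hB]; exact_mod_cast Nat.le_add_left 1 _
  have hGle : (Nat.card G : ℝ) ≤ 2 ^ B := by
    have h1 : Nat.card G ≤ X + 1 := by
      simpa using Nat.card_le_card_of_injective (fun p : G => (⟨p.1, Nat.lt_succ_of_le p.2.2.1⟩ : Fin (X + 1)))
        fun p q h => Subtype.ext (by simpa using congrArg Fin.val h)
    exact_mod_cast h1.trans hXB
  have hratio : 1 / (8 * (B : ℝ)) ≤ (Nat.card G : ℝ) / 2 ^ B := by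
    rw [div_le_div_iff₀ (by positivity) (by positivity), one_mul]
    have h1 : ((2 : ℕ) ^ B : ℝ) ≤ 2 * X := by exact_mod_cast h2B
    have h2 : (X : ℝ) ≤ 4 * B * Nat.card G := by rw [hB]; exact_mod_cast hdens
    push_cast at h1
    nlinarith
  have hshort : ((600 * B ^ 2 : ℕ) : ℝ) * (1 - (Nat.card G : ℝ) / 2 ^ B) ^ (38400 * B ^ 3) ≤ 1 / 16 := by
    have h0 : (0 : ℝ) ≤ 1 - (Nat.card G : ℝ) / 2 ^ B := by
      rw [sub_nonneg, div_le_one (by positivity)]; exact hGle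
    have hpow : (1 - (Nat.card G : ℝ) / 2 ^ B) ^ (38400 * B ^ 3) ≤ Real.exp (-(8 * (600 * (B : ℝ) ^ 2))) := by
      calc (1 - (Nat.card G : ℝ) / 2 ^ B) ^ (38400 * B ^ 3)
          ≤ (1 - 1 / (8 * (B : ℝ))) ^ (38400 * B ^ 3) := pow_le_pow_left₀ h0 (by linarith) _
        _ ≤ (Real.exp (-(1 / (8 * (B : ℝ))))) ^ (38400 * B ^ 3) :=
            pow_le_pow_left₀ (by rw [sub_nonneg, div_le_one (by positivity)]; linarith) (Real.one_sub_le_exp_neg _) _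
        _ = Real.exp (-(8 * (600 * (B : ℝ) ^ 2))) := by
            rw [← Real.exp_nat_mul]; congr 1; push_cast; field_simp; ring
    calc ((600 * B ^ 2 : ℕ) : ℝ) * (1 - (Nat.card G : ℝ) / 2 ^ B) ^ (38400 * B ^ 3)
        ≤ (600 * (B : ℝ) ^ 2) * Real.exp (-(8 * (600 * (B : ℝ) ^ 2))) := by
          push_cast; exact mul_le_mul_of_nonneg_left hpow (by positivity)
      _ ≤ 1 / 16 := assemblyCoins_exp_bound _ (by positivity)
  -- only the first `TMB` coins are read
  have hacc : ∀ c : List Bool,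
      ((List.range (600 * B ^ 2)).filterMap fun k => ((List.range (38400 * B ^ 3)).map fun j =>
        bitsToNat (((c.take (600 * B ^ 2 * (38400 * B ^ 3 * B))).drop ((k * (38400 * B ^ 3) + j) * B)).take B)).find?
          fun v => decide (v.Prime ∧ v ≤ X ∧ ¬ v ∣ 3 * m)) =
      ((List.range (600 * B ^ 2)).filterMap fun k => ((List.range (38400 * B ^ 3)).map fun j =>
        bitsToNat ((c.drop ((k * (38400 * B ^ 3) + j) * B)).take B)).find? fun v => decide (v.Prime ∧ v ≤ X ∧ ¬ v ∣ 3 * m)) := by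
    intro c
    refine List.filterMap_congr fun k hk => ?_
    rw [List.map_congr_left fun j hj => ?_]
    rw [List.mem_range] at hk hj
    have h1 : k * (38400 * B ^ 3) + j + 1 ≤ 600 * B ^ 2 * (38400 * B ^ 3) := by
      have : (k + 1) * (38400 * B ^ 3) ≤ 600 * B ^ 2 * (38400 * B ^ 3) := Nat.mul_le_mul_right _ hk
      rw [Nat.succ_mul] at this
      omega
    have hle : (k * (38400 * B ^ 3) + j) * B + B ≤ 600 * B ^ 2 * (38400 * B ^ 3 * B) :=
      calc (k * (38400 * B ^ 3) + j) * B + B = (k * (38400 * B ^ 3) + j + 1) * B := by ring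
        _ ≤ 600 * B ^ 2 * (38400 * B ^ 3) * B := Nat.mul_le_mul_right _ h1
        _ = 600 * B ^ 2 * (38400 * B ^ 3 * B) := by ring
    rw [List.drop_take, List.take_take, Nat.min_eq_left (by omega)]
  exact assemblyCoins_finish hq (fun c => by rw [Set.mem_setOf_eq, Set.mem_setOf_eq, hacc c])
    (fun c => or_iff_not_imp_left.2 fun hc => Or.inr hc) key (by linarith only [hshort])

end Summit.QuantumAdvantage.QuantumAdvantage.Theorems.LinnikCubicClassGroups
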